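import Summits.QuantumFields.BalabanUV.T4Continuum.Support.InsertionChannelReading
import Summits.QuantumFields.BalabanUV.T4Continuum.Support.OutputRateFunctionalTablesComplex

/-!
# InsertionChannelRealify — the INPUT-SIDE junction of Road D's complex chart (owner R49 (4)): a COMPLEX localization channel on
# complex background families, READ AS row NE9's REAL channel on the DOUBLED chart `𝒰 × Fin 2` with TWO output rows; its four
# structure binders transfer EXACTLY and its per-creation-step size binder transfers with the profile `√2·τ` (per-row majorants of
# the two real rows ⟹ a modulus majorant `√2·N`) — the typed form of the «honest rider» of the channel road's complex parts
# (cell `pub-balaban`, T⁴ fan-out; row NE5, node U3; R48-F ROAD D of record, `HOME/CLAIMS.log` l.16073; this lineage's parts 1–5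
# `OutputRateFunctionalTables*` p224211 ∕ p224773 ∕ p225051 ∕ p227801 ∕ p229585; leaf-06's channel road `InsertionChannelFamily*`;
# journal OFFER l.19004)

Unit `b2b-balaban-t4-ne5-formalise-leaf-02` (NE5 formalisation swarm, leaf prover 02, gen 18).  Summits-side NEW WORK under the LEAN
PLACEMENT RULE (cell modelling + bookkeeping over ABSTRACT carriers; nothing of the manuscripts under audit is asserted; 0 cite tags; no
`Prop`-valued fact minted — the three `def`s are DATA: the complexification of a two-row real family, the realification of a complex
channel, and the toy evaluation channel of the §4 witness).  HONEST FRAMING: rung (B)+1 of the FINITE-VOLUME T⁴ continuum programme — NOT infinite volume, NOT a mass gap, NOT the Clay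
problem, NOT a proof of NE5 (`T4OutputRate.NE5`, NOT PRINTED; cell GAPS G-t4-U3-1) nor of NE9; spine 0/9 unchanged; 0/12 leaves
instantiated on Bałaban's concrete objects (O1 = the substrate cell, owner R34).  HONEST DEPENDENCY (cell line, verbatim): continuum
YM on T⁴ ⇐ BetaPertH ∧ nine spine estimates (0/9 proved); BetaPertH ⇐ (D1) ∧ (D4) ∧ CAP+tail; G-an2-4 gates asym, D1 and NE2/3/4.

WHY.  On Road D's complex chart the complex values of Bałaban's earlier terms ride as TWO REAL ROWS of the chart `𝒰 × Fin 2`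
(`OutputRateFunctionalTablesComplex.reImTab`), and the channel road's complex parts (leaf-06 `InsertionChannelFamilyComplex`) read row
NE9's REAL channel vocabulary (`T4HistoryLipschitzRecursion.ChannelAdditive ∕ ChannelLocal ∕ ChannelStepSum ∕ ChannelSizeAtStepNN`,
`InsertionChannelReading.ChannelHomog`) ON THE DOUBLED CHART, with two output indices per history entry (row `0` ↦ real part, row `1` ↦
imaginary part), under the displayed rider «whether row NE9 supplies these binders there is row NE9's ∕ the substrate's reading».  At a
complex background the localization (1.33) p. 9 of [Balaban1988RG2Cluster] is ONE complex-valued operator on complex-valued families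
(Cauchy formulas (1.23) p. 7).  This file TYPES the dictionary between the two: given a complex channel `Tc` with its own (displayed,
asserted by nobody) structure and MODULUS-majorant size binders, its realification `realify Tc` on two-row families IS a real channel
of row NE9's vocabulary — structure binders EXACTLY, size binder with profile `√2·τ`, because row NE9's binder majorises the input
family ROW BY ROW (`|H (u,j) X| ≤ e^{−κd}·N` for both rows) and two per-row majorants give the modulus majorant `√2·N` and no better
(`Complex.norm_le_sqrt_two_mul_max`; sharp at `|Re| = |Im|`).  Composed with the channel road's output-side `√2`
(`InsertionChannelFamilyComplex.norm_add_I_smul_le`) the END's gain is `2·c` for a complex operator of profile `c` — the factor `2` of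
`NE9ComplexEncoding.norm_sub_le_of_ne9_reIm` by another route.  No estimate; no NE9 binder is discharged for Bałaban's operator.

WHAT THIS FILE TYPES ([folklore] bookkeeping; 0 sorry):
* §1 DATA `complexify H u X := H (u,0) X + I·H (u,1) X` (two-row real family ↦ complex family) with `complexify_sub ∕ _smul ∕ _zero`,
  `complexify_re ∕ _im`, `norm_complexify_le` (per-row `≤ A` ⟹ modulus `≤ √2·A`), `complexify_eq_zero` ∕ `complexify_congr`
  (support ∕ agreement transfer), `complexify_truncScale`.
* §2 DATA `realify Tc k s H (y, r) := reIm r (Tc k s (complexify H) y)` (row NE9's real channel type on the doubled chart, outputs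
  `ιc × Fin 2`); `realify_apply_zero ∕ _one`; `re_add_I_im_realify` — the two output rows reassemble the complex output; `abs_realify_le`.
* §3 THE TRANSFERS (all on the class of ALL families, `Set.univ`, as the channel road consumes them): `channelAdditive_realify`
  (⟸ complex additivity), `channelHomog_realify` (⟸ real homogeneity of `Tc`), `channelLocal_realify` (⟸ complex locality in
  AGREEMENT form: families agreeing on the creation steps `≤ k` have the same step-`k` outputs), `channelStepSum_realify` (from the two,
  by the kernel's `channelStepSum_of_local`), and **`channelSizeAtStepNN_realify`**: the complex per-creation-step size binder with
  MODULUS majorant, weights `wtc`, profile `τ` ⟹ `ChannelSizeAtStepNN univ (realify Tc) κ (fun k y ↦ wtc k y.1) (fun k j ↦ √2·τ k j)`;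
  `profile_sqrt_two` (`τ k j ≤ c·ω^{k−j}` ⟹ `√2·τ k j ≤ (√2·c)·ω^{k−j}`).
* §4 NON-VACUITY: the toy complex EVALUATION channel `evalChannelC` (output `(u, X)` ↦ the family's value there if created at a step
  `≤ k`) satisfies every displayed complex-side letter (`evalChannelC_add ∕ _smul ∕ _local ∕ _size`, weights `e^{−κd(X)}`, flat
  profile `1`), so `realify_evalChannelC_binders` exhibits row NE9's five binders on the doubled chart for a non-zero channel (profile `√2`).
NOT IN THIS FILE (said plainly).  No instance on Bałaban's objects (which complex operator `Tc`, output index `outc`, weights serve the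
record is the substrate's O-8 ∕ D-8 reading); the complex binders of `Tc` are HYPOTHESES displayed at each use, not named facts; the
junction with `InsertionChannelFamilyComplex.read_insAtC_succ` ∕ `ne5_of_pointwiseSlots_reIm_insAtC` (output map `out (u,r) i :=
(outc u i, r)`, gain `2·c`) is one application BY NAME and is left to that module's consumer.  Headline wording: «Road D complex chart —
input-side realification dictionary, junction only»; never «leaf instantiated».  NE5 NOT PROVED; NE9 NOT PROVED; spine 0/9; rung (B)+1
finite T⁴; NOT infinite volume ∕ mass gap ∕ Clay.  Axioms ⊆ {propext, Classical.choice, Quot.sound}.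
-/

noncomputable section

open scoped BigOperators
open Finset Function Set Complex

namespace Summit.QuantumFields.BalabanUV.T4Continuum.InsertionChannelRealify

open Literature.MathematicalPhysics.QuantumFieldTheory.Balaban1983to89
open Literature.MathematicalPhysics.QuantumFieldTheory.Balaban1983to89.T4OutputRate (Carriers)
open Literature.MathematicalPhysics.QuantumFieldTheory.Balaban1983to89.T4HistoryLipschitzRecursion
  (ChannelAdditive ChannelLocal ChannelStepSum ChannelSizeAtStepNN AdmRestrict truncScale restrictScale channelStepSum_of_local)
open Summit.QuantumFields.BalabanUV.T4Continuum.InsertionChannelReading (ChannelHomog)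
open Summit.QuantumFields.BalabanUV.T4Continuum.OutputRateFunctionalTablesComplex (reIm reIm_zero reIm_one abs_reIm_le)

variable {C : Carriers} {𝒰 ιc : Type}

/-! ## §1 The complexification of a two-row real family -/

section Complexify

/-- [folklore] DATA: the COMPLEX background family of a two-row real family on the doubled chart — row `0` is the real part, row `1`
the imaginary part (the inverse reading of `OutputRateFunctionalTablesComplex.reImTab` on families). -/
def complexify (H : 𝒰 × Fin 2 → C.Dom → ℝ) : 𝒰 → C.Dom → ℂ :=
  fun u X => (H (u, 0) X : ℂ) + I * (H (u, 1) X : ℂ)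

/-- [folklore] `complexify`, evaluated. -/
@[simp] theorem complexify_apply (H : 𝒰 × Fin 2 → C.Dom → ℝ) (u : 𝒰) (X : C.Dom) :
    complexify H u X = (H (u, 0) X : ℂ) + I * (H (u, 1) X : ℂ) := rfl

/-- [folklore] The real part of the complexified family is row `0`. -/
@[simp] theorem complexify_re (H : 𝒰 × Fin 2 → C.Dom → ℝ) (u : 𝒰) (X : C.Dom) : (complexify H u X).re = H (u, 0) X := by
  simp [complexify]

/-- [folklore] The imaginary part of the complexified family is row `1`. -/
@[simp] theorem complexify_im (H : 𝒰 × Fin 2 → C.Dom → ℝ) (u : 𝒰) (X : C.Dom) : (complexify H u X).im = H (u, 1) X := by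
  simp [complexify]

/-- [folklore] `complexify` is additive: differences. -/
theorem complexify_sub (H₁ H₂ : 𝒰 × Fin 2 → C.Dom → ℝ) : complexify (H₁ - H₂) = complexify H₁ - complexify H₂ := by
  funext u X
  simp only [complexify_apply, Pi.sub_apply, ofReal_sub]
  ring

/-- [folklore] `complexify` is ℝ-homogeneous. -/
theorem complexify_smul (a : ℝ) (H : 𝒰 × Fin 2 → C.Dom → ℝ) : complexify (a • H) = fun u X => (a : ℂ) * complexify H u X := by
  funext u X
  simp only [complexify_apply, Pi.smul_apply, smul_eq_mul, ofReal_mul]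
  ring

/-- [folklore] The zero family complexifies to zero. -/
@[simp] theorem complexify_zero : complexify (0 : 𝒰 × Fin 2 → C.Dom → ℝ) = fun _ _ => 0 := by
  funext u X
  simp [complexify]

/-- [folklore] **TWO PER-ROW MAJORANTS GIVE THE MODULUS MAJORANT `√2·A`** (`Complex.norm_le_sqrt_two_mul_max`; sharp at `|Re| = |Im|`). -/
theorem norm_complexify_le {H : 𝒰 × Fin 2 → C.Dom → ℝ} {u : 𝒰} {X : C.Dom} {A : ℝ} (h : ∀ r : Fin 2, |H (u, r) X| ≤ A) :
    ‖complexify H u X‖ ≤ Real.sqrt 2 * A := by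
  refine (norm_le_sqrt_two_mul_max _).trans (mul_le_mul_of_nonneg_left (max_le ?_ ?_) (Real.sqrt_nonneg _))
  · rw [complexify_re]; exact h 0
  · rw [complexify_im]; exact h 1

/-- [folklore] A two-row family vanishing at `(u, ·, X)` complexifies to `0` there. -/
theorem complexify_eq_zero {H : 𝒰 × Fin 2 → C.Dom → ℝ} {u : 𝒰} {X : C.Dom} (h : ∀ r : Fin 2, H (u, r) X = 0) :
    complexify H u X = 0 := by
  rw [complexify_apply, h 0, h 1]; simp

/-- [folklore] Two-row families agreeing at `(u, ·, X)` have the same complexification there. -/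
theorem complexify_congr {H H' : 𝒰 × Fin 2 → C.Dom → ℝ} {u : 𝒰} {X : C.Dom} (h : ∀ r : Fin 2, H (u, r) X = H' (u, r) X) :
    complexify H u X = complexify H' u X := by
  rw [complexify_apply, complexify_apply, h 0, h 1]

/-- [folklore] Complexification commutes with the kernel's truncation to the creation steps `≤ k` (read in agreement form). -/
theorem complexify_truncScale (k : ℕ) (H : 𝒰 × Fin 2 → C.Dom → ℝ) (u : 𝒰) (X : C.Dom) :
    complexify (truncScale k H) u X = if C.scale X ≤ k then complexify H u X else 0 := by
  by_cases hX : C.scale X ≤ k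
  · rw [if_pos hX]
    exact complexify_congr fun r => by simp [truncScale, hX]
  · rw [if_neg hX]
    exact complexify_eq_zero fun r => by simp [truncScale, hX]

end Complexify

/-! ## §2 The realification of a complex channel: row NE9's real channel type on the doubled chart, two output rows -/

section Realify

variable (Tc : ℕ → (ℕ → ℝ) → (𝒰 → C.Dom → ℂ) → ιc → ℂ)

/-- [folklore] DATA: **THE REALIFICATION OF A COMPLEX CHANNEL** — row NE9's channel type on the DOUBLED chart `𝒰 × Fin 2` with the
output index doubled: at `(y, 0)` the real part, at `(y, 1)` the imaginary part of the complex output at `y` on the complexified family. -/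
def realify : ℕ → (ℕ → ℝ) → (𝒰 × Fin 2 → C.Dom → ℝ) → ιc × Fin 2 → ℝ :=
  fun k s H y => reIm y.2 (Tc k s (complexify H) y.1)

/-- [folklore] `realify`, evaluated. -/
theorem realify_apply (k : ℕ) (s : ℕ → ℝ) (H : 𝒰 × Fin 2 → C.Dom → ℝ) (y : ιc × Fin 2) :
    realify Tc k s H y = reIm y.2 (Tc k s (complexify H) y.1) := rfl

/-- [folklore] Output row `0` is the real part. -/
@[simp] theorem realify_apply_zero (k : ℕ) (s : ℕ → ℝ) (H : 𝒰 × Fin 2 → C.Dom → ℝ) (y : ιc) :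
    realify Tc k s H (y, 0) = (Tc k s (complexify H) y).re := rfl

/-- [folklore] Output row `1` is the imaginary part. -/
@[simp] theorem realify_apply_one (k : ℕ) (s : ℕ → ℝ) (H : 𝒰 × Fin 2 → C.Dom → ℝ) (y : ιc) :
    realify Tc k s H (y, 1) = (Tc k s (complexify H) y).im := rfl

/-- [folklore] **THE TWO OUTPUT ROWS REASSEMBLE THE COMPLEX OUTPUT** — the shape `InsertionChannelFamilyComplex.read_insAtC_succ`
delivers with the output map `out (u, r) i := (outc u i, r)`: the inserted entry IS the complex channel output, no cast. -/
theorem re_add_I_im_realify (k : ℕ) (s : ℕ → ℝ) (H : 𝒰 × Fin 2 → C.Dom → ℝ) (y : ιc) :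
    ((realify Tc k s H (y, 0) : ℝ) : ℂ) + I * ((realify Tc k s H (y, 1) : ℝ) : ℂ) = Tc k s (complexify H) y := by
  rw [realify_apply_zero, realify_apply_one]
  exact Complex.ext (by simp) (by simp)

/-- [folklore] Each output row is bounded by the modulus of the complex output. -/
theorem abs_realify_le (k : ℕ) (s : ℕ → ℝ) (H : 𝒰 × Fin 2 → C.Dom → ℝ) (y : ιc × Fin 2) :
    |realify Tc k s H y| ≤ ‖Tc k s (complexify H) y.1‖ :=
  abs_reIm_le _ _

end Realify

/-! ## §3 The transfers: structure binders exactly, the size binder with profile `√2·τ` -/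

section Transfers

variable {Tc : ℕ → (ℕ → ℝ) → (𝒰 → C.Dom → ℂ) → ιc → ℂ}

/-- [folklore] The class of ALL two-row families is closed under one-step restriction and truncation. -/
theorem admRestrict_univ₂ : AdmRestrict (C := C) (Set.univ : Set (𝒰 × Fin 2 → C.Dom → ℝ)) :=
  ⟨fun _ _ _ => Set.mem_univ _, fun _ _ _ => Set.mem_univ _⟩

/-- [folklore] **ADDITIVITY TRANSFERS EXACTLY**: a complex channel additive on all complex families realifies to a `ChannelAdditive`
real channel on all two-row families. -/
theorem channelAdditive_realify
    (haddC : ∀ (k : ℕ) (s : ℕ → ℝ) (H₁ H₂ : 𝒰 → C.Dom → ℂ) (y : ιc), Tc k s (H₁ - H₂) y = Tc k s H₁ y - Tc k s H₂ y) :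
    ChannelAdditive (Set.univ : Set (𝒰 × Fin 2 → C.Dom → ℝ)) (realify Tc) := by
  intro k s H₁ _ H₂ _ y
  rw [realify_apply, realify_apply, realify_apply, complexify_sub, haddC,
    OutputRateFunctionalTablesComplex.reIm_sub]

/-- [folklore] **REAL HOMOGENEITY TRANSFERS EXACTLY** (`InsertionChannelReading.ChannelHomog`): a complex channel homogeneous under
REAL scalars on all complex families realifies to a `ChannelHomog` real channel. -/
theorem channelHomog_realify
    (hhomC : ∀ (k : ℕ) (s : ℕ → ℝ) (H : 𝒰 → C.Dom → ℂ) (a : ℝ) (y : ιc),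
      Tc k s (fun u X => (a : ℂ) * H u X) y = (a : ℂ) * Tc k s H y) :
    ChannelHomog (Set.univ : Set (𝒰 × Fin 2 → C.Dom → ℝ)) (realify Tc) := by
  intro k s H _ a y
  rw [realify_apply, realify_apply, complexify_smul, hhomC]
  obtain ⟨y, r⟩ := y
  fin_cases r
  · simp [reIm]
  · simp [reIm]

/-- [folklore] **LOCALITY TRANSFERS EXACTLY**: a complex channel whose step-`k` outputs depend only on the creation steps `≤ k`
(AGREEMENT form: complex families agreeing on the scales `≤ k` have the same step-`k` outputs) realifies to a `ChannelLocal` real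
channel (the kernel's `truncScale` form). -/
theorem channelLocal_realify
    (hlocC : ∀ (k : ℕ) (s : ℕ → ℝ) (H H' : 𝒰 → C.Dom → ℂ), (∀ u X, C.scale X ≤ k → H u X = H' u X) →
      ∀ y : ιc, Tc k s H y = Tc k s H' y) :
    ChannelLocal (Set.univ : Set (𝒰 × Fin 2 → C.Dom → ℝ)) (realify Tc) := by
  intro k s H _ y
  rw [realify_apply, realify_apply, hlocC k s (complexify H) (complexify (truncScale k H)) (fun u X hX => by
    rw [complexify_truncScale, if_pos hX]) y.1]

/-- [folklore] **THE STEP-SUM STRUCTURE** of the realification from additivity + locality (the kernel's `channelStepSum_of_local` on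
the class of all two-row families). -/
theorem channelStepSum_realify
    (haddC : ∀ (k : ℕ) (s : ℕ → ℝ) (H₁ H₂ : 𝒰 → C.Dom → ℂ) (y : ιc), Tc k s (H₁ - H₂) y = Tc k s H₁ y - Tc k s H₂ y)
    (hlocC : ∀ (k : ℕ) (s : ℕ → ℝ) (H H' : 𝒰 → C.Dom → ℂ), (∀ u X, C.scale X ≤ k → H u X = H' u X) →
      ∀ y : ιc, Tc k s H y = Tc k s H' y) :
    ChannelStepSum (Set.univ : Set (𝒰 × Fin 2 → C.Dom → ℝ)) (realify Tc) :=
  channelStepSum_of_local admRestrict_univ₂ (channelAdditive_realify haddC) (channelLocal_realify hlocC)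

/-- [folklore] **THE SIZE BINDER TRANSFERS WITH PROFILE `√2·τ`** — row NE9's per-creation-step size binder
`ChannelSizeAtStepNN univ (realify Tc) κ (fun k y ↦ wtc k y.1) (fun k j ↦ √2·τ k j)` from the complex channel's size binder with
MODULUS majorant (displayed: a complex family supported on the creation step `j ≤ k` with `‖H u X‖ ≤ e^{−κd(X)}·N` there has outputs
`‖Tc k s H y‖ ≤ wtc k y·(τ k j·N)`): row NE9's binder majorises the two real rows SEPARATELY (`|H (u,r) X| ≤ e^{−κd}·N`), which gives
the modulus majorant `√2·e^{−κd}·N` (§1) and no better; each output row is bounded by the modulus of the complex output (§2). -/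
theorem channelSizeAtStepNN_realify {κ : ℝ} {wtc : ℕ → ιc → ℝ} {τ : ℕ → ℕ → ℝ}
    (hsizeC : ∀ (k j : ℕ), j ≤ k → ∀ (s : ℕ → ℝ) (H : 𝒰 → C.Dom → ℂ), (∀ u X, C.scale X ≠ j → H u X = 0) →
      ∀ N : ℝ, 0 ≤ N → (∀ u X, C.scale X = j → ‖H u X‖ ≤ Real.exp (-(κ * C.d X)) * N) →
        ∀ y : ιc, ‖Tc k s H y‖ ≤ wtc k y * (τ k j * N)) :
    ChannelSizeAtStepNN (Set.univ : Set (𝒰 × Fin 2 → C.Dom → ℝ)) (realify Tc) κ (fun k y => wtc k y.1)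
      (fun k j => Real.sqrt 2 * τ k j) := by
  intro k j hjk s H _ hsupp N hN hbd y
  have hsuppC : ∀ u X, C.scale X ≠ j → complexify H u X = 0 := fun u X hX => complexify_eq_zero fun r => hsupp (u, r) X hX
  have hbdC : ∀ u X, C.scale X = j → ‖complexify H u X‖ ≤ Real.exp (-(κ * C.d X)) * (Real.sqrt 2 * N) := by
    intro u X hX
    calc ‖complexify H u X‖ ≤ Real.sqrt 2 * (Real.exp (-(κ * C.d X)) * N) := norm_complexify_le fun r => hbd (u, r) X hX
      _ = Real.exp (-(κ * C.d X)) * (Real.sqrt 2 * N) := by ring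
  calc |realify Tc k s H y| ≤ ‖Tc k s (complexify H) y.1‖ := abs_realify_le Tc k s H y
    _ ≤ wtc k y.1 * (τ k j * (Real.sqrt 2 * N)) :=
        hsizeC k j hjk s _ hsuppC (Real.sqrt 2 * N) (mul_nonneg (Real.sqrt_nonneg _) hN) hbdC y.1
    _ = wtc k y.1 * (Real.sqrt 2 * τ k j * N) := by ring

/-- [folklore] The geometric PROFILE with the factor `√2`: `τ k j ≤ c·ω^{k−j}` ⟹ `√2·τ k j ≤ (√2·c)·ω^{k−j}` — the letter the
channel road's ENDs consume (`hτ`), with `c ↦ √2·c`. -/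
theorem profile_sqrt_two {τ : ℕ → ℕ → ℝ} {c ω : ℝ} (hτ : ∀ k j, j ≤ k → τ k j ≤ c * ω ^ (k - j)) :
    ∀ k j, j ≤ k → Real.sqrt 2 * τ k j ≤ Real.sqrt 2 * c * ω ^ (k - j) := fun k j hjk => by
  rw [mul_assoc]
  exact mul_le_mul_of_nonneg_left (hτ k j hjk) (Real.sqrt_nonneg _)

end Transfers

/-! ## §4 Non-vacuity: the EVALUATION channel satisfies every displayed complex-side letter (so the transfers of §3 are not about
the empty class) -/

section Witness

variable (C) (𝒰)

/-- [folklore] DATA (toy): the complex EVALUATION channel — output index `(u, X)`, output = the family's own value at `(u, X)` when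
`X` was created at a step `≤ k`, else `0`.  (Not Bałaban's operator; a witness that the displayed complex letters are jointly
satisfiable by a non-zero channel, with weights `wtc k (u, X) := e^{−κd(X)}` and the flat profile `τ k j := 1`.) -/
def evalChannelC : ℕ → (ℕ → ℝ) → (𝒰 → C.Dom → ℂ) → 𝒰 × C.Dom → ℂ :=
  fun k _ H y => if C.scale y.2 ≤ k then H y.1 y.2 else 0

variable {C} {𝒰}

/-- [folklore] The evaluation channel, evaluated. -/
theorem evalChannelC_apply (k : ℕ) (s : ℕ → ℝ) (H : 𝒰 → C.Dom → ℂ) (y : 𝒰 × C.Dom) :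
    evalChannelC C 𝒰 k s H y = if C.scale y.2 ≤ k then H y.1 y.2 else 0 := rfl

/-- [folklore] Witness: complex additivity. -/
theorem evalChannelC_add (k : ℕ) (s : ℕ → ℝ) (H₁ H₂ : 𝒰 → C.Dom → ℂ) (y : 𝒰 × C.Dom) :
    evalChannelC C 𝒰 k s (H₁ - H₂) y = evalChannelC C 𝒰 k s H₁ y - evalChannelC C 𝒰 k s H₂ y := by
  simp only [evalChannelC_apply, Pi.sub_apply]
  split_ifs <;> simp

/-- [folklore] Witness: real homogeneity. -/
theorem evalChannelC_smul (k : ℕ) (s : ℕ → ℝ) (H : 𝒰 → C.Dom → ℂ) (a : ℝ) (y : 𝒰 × C.Dom) :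
    evalChannelC C 𝒰 k s (fun u X => (a : ℂ) * H u X) y = (a : ℂ) * evalChannelC C 𝒰 k s H y := by
  simp only [evalChannelC_apply]
  split_ifs <;> simp

/-- [folklore] Witness: locality in agreement form. -/
theorem evalChannelC_local (k : ℕ) (s : ℕ → ℝ) (H H' : 𝒰 → C.Dom → ℂ) (h : ∀ u X, C.scale X ≤ k → H u X = H' u X)
    (y : 𝒰 × C.Dom) : evalChannelC C 𝒰 k s H y = evalChannelC C 𝒰 k s H' y := by
  simp only [evalChannelC_apply]
  split_ifs with hy
  · exact h y.1 y.2 hy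
  · rfl

/-- [folklore] Witness: the per-creation-step size binder with MODULUS majorant, weights `e^{−κd(X)}`, flat profile `1`. -/
theorem evalChannelC_size (κ : ℝ) (k j : ℕ) (_hjk : j ≤ k) (s : ℕ → ℝ) (H : 𝒰 → C.Dom → ℂ)
    (hsupp : ∀ u X, C.scale X ≠ j → H u X = 0) (N : ℝ) (hN : 0 ≤ N)
    (hbd : ∀ u X, C.scale X = j → ‖H u X‖ ≤ Real.exp (-(κ * C.d X)) * N) (y : 𝒰 × C.Dom) :
    ‖evalChannelC C 𝒰 k s H y‖ ≤ (fun (_ : ℕ) (y : 𝒰 × C.Dom) => Real.exp (-(κ * C.d y.2))) k y * ((fun _ _ : ℕ => (1 : ℝ)) k j * N) := by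
  have h0 : 0 ≤ Real.exp (-(κ * C.d y.2)) * (1 * N) := mul_nonneg (Real.exp_pos _).le (by rw [one_mul]; exact hN)
  simp only [evalChannelC_apply]
  split_ifs with hy
  · by_cases hX : C.scale y.2 = j
    · rw [one_mul]; exact hbd y.1 y.2 hX
    · rw [hsupp y.1 y.2 hX, norm_zero]; exact h0
  · rw [norm_zero]; exact h0

/-- [folklore] **NON-VACUITY**: the realified evaluation channel carries row NE9's four structure binders and the size binder with
profile `√2` on the doubled chart — every transfer of §3 fires on a non-zero complex channel. -/
theorem realify_evalChannelC_binders (κ : ℝ) :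
    ChannelAdditive (Set.univ : Set (𝒰 × Fin 2 → C.Dom → ℝ)) (realify (evalChannelC C 𝒰)) ∧
      ChannelHomog (Set.univ : Set (𝒰 × Fin 2 → C.Dom → ℝ)) (realify (evalChannelC C 𝒰)) ∧
        ChannelLocal (Set.univ : Set (𝒰 × Fin 2 → C.Dom → ℝ)) (realify (evalChannelC C 𝒰)) ∧
          ChannelStepSum (Set.univ : Set (𝒰 × Fin 2 → C.Dom → ℝ)) (realify (evalChannelC C 𝒰)) ∧
            ChannelSizeAtStepNN (Set.univ : Set (𝒰 × Fin 2 → C.Dom → ℝ)) (realify (evalChannelC C 𝒰)) κ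
              (fun _ y => Real.exp (-(κ * C.d y.1.2))) (fun _ _ => Real.sqrt 2 * 1) :=
  ⟨channelAdditive_realify (evalChannelC_add (C := C) (𝒰 := 𝒰)),
    channelHomog_realify (evalChannelC_smul (C := C) (𝒰 := 𝒰)),
    channelLocal_realify (evalChannelC_local (C := C) (𝒰 := 𝒰)),
    channelStepSum_realify (evalChannelC_add (C := C) (𝒰 := 𝒰)) (evalChannelC_local (C := C) (𝒰 := 𝒰)),
    channelSizeAtStepNN_realify (evalChannelC_size (C := C) (𝒰 := 𝒰) κ)⟩

end Witness

end Summit.QuantumFields.BalabanUV.T4Continuum.InsertionChannelRealify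

end
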